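import Literature.NumberTheory.EllipticCurves.InertiaFixedTorsionAdditiveVanishingProofs
import Literature.NumberTheory.EllipticCurves.FineSelmerTrivialOfSelmerTrivial
import Literature.NumberTheory.EllipticCurves.Rank1Residual.Typed.X11Visibility
import Summits.BirchSwinnertonDyer.Rank1Residual.X11b.AnticyclotomicLocalTorsionDescent
import HarnessLib

/-!
# Route `KatoDescentTamePotSupersingular` (rung K8, sub-rung B4 (t′), cell `bsd-potss`): the SELMER-TRIVIAL (A)-DOOR in record-lane form
# (seat `bsd-potss-k8t-c4` g27; `--supports stmt-BirchSwinnertonDyer-19982 --as helper`; closes nothing)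

HONEST FRAMING. THEOREMS ONLY (no definition, no named fact, no `sorry`); nothing is booked; BSD is proved for no curve; Coates–Sujatha's
statement (A) is proved for no CLASS of curves. This file packages conjA-anchor g24's Literature road
`CoatesSujatha2005.SelmerTrivialRoad.conjAAt_of_not_dvd_card_of_not_dvd_shaOrder` («`p ∤ #E(ℚ)`, `p ∤ #Ш(E/ℚ)`, (c3) at `p` and the
bad primes ⟹ `Sel₀(ℚ_∞, E[p]) = 0` ⟹ (A) at `(E, p)`», GRH-free, class-group-free, image-free) for the per-row records of the K8-t′ U₀-ns
table (items 19202 → 19982; (A)-table aside 19413), with the two arithmetic binders REDUCED to the row currency of this lane: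

* §1 `hlocp_of_padic`: the (c3) clause at the places `v ∋ p` of `ℚ` from ONE statement over Mathlib's `ℚ_[p]`,
  `∀ Q ∈ E(ℚ_p), p • Q = 0 → Q = 0` (transport along `Padic.adicCompletionEquiv`, then the Summit-side pro-finite descent
  `X11b.AcSelmer.eq_zero_of_fixed_decomp_of_local`); `hloc_of_dvd_pow_mul_pow_of_padic`: the WHOLE binder `hloc` when every bad
  prime `ℓ ≠ p` is additive, read off ONE divisibility `Δ_min ∣ p^a · c₄^b` (conjA-anchor g25, Literature p745700
  `geomPrimaryTorsion_decomp_fixed_eq_zero_of_dvd_pow_mul_pow`).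
* §2 `not_dvd_natCard_point_of_irr`: `p ∤ #E(ℚ)` ⟸ GZK at `r_an = 0` (E(ℚ) finite) + `E[p]` irreducible (no rational `p`-torsion, Mazur);
  `not_dvd_shaOrder_of_missingUpperBoundAt`: `p ∤ #Ш(E/ℚ)` ⟸ GZK (Ш finite) + the row's U₀ statement `MissingUpperBoundAt W p`
  + ONE displayed datum `#Ш_an(E) = s` with `ord_p s ≤ 0`.
* §3 the doors: `conjAAt_of_not_dvd_of_dvd_pow_mul_pow_of_padic` (g24's displayed binders `hMW hsha`, kernel `hloc`) and
  `conjAAt_of_missingUpperBoundAt_of_padic` ((A) at `(E,p)` ⟸ `hGZK` + `r_an = 0` + `E[p]` irreducible + U₀ at `(E,p)` + `#Ш_an = s`,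
  `ord_p s ≤ 0` + `Δ_min ∣ p^a c₄^b` + `E(ℚ_p)[p] = 0`), plus the literal `∀ κ` forms of the stub `stub_fineA_tame_five_le`.

What a record through these doors MEANS: on a rank-`0` row whose U₀ statement is recorded (any of the lane's U₀ records) and whose
`#Ш_an` is prime to `p`, statement (A) at `(E,p)` follows from the SAME published inputs as that U₀ record plus GZK — no class group,
no `μ`, no GRH, no image hypothesis. It is NOT a new road to U₀ (through `hKatoA` it would be circular); it serves the (A)-table.

References: [CoatesSujatha2005] §3 statement (A); [RaySujatha2021] Cor. 2.7; [GreenbergLNM1716] §3; [DeoRaySujatha2023] Thm. 3.9 (c3);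
[SilvermanAEC2009] VII.5.1, VII.6.1–6.2, VIII.6; [Mazur1977] III.§5; [Miller2011LMS] Def. 1.1; [Darmon2004] Thm. 3.22.
-/

set_option autoImplicit false
set_option linter.dupNamespace false

noncomputable section

open scoped Classical NumberField
open WeierstrassCurve NumberField IsDedekindDomain IsDedekindDomain.HeightOneSpectrum Rat.HeightOneSpectrum Field
  Literature.NumberTheory.EllipticCurves Literature.NumberTheory.EllipticCurves.GreenbergSelmer
  Literature.NumberTheory.EllipticCurves.Rank1Residual Literature.NumberTheory.EllipticCurves.Rank1Residual.Typed
  Summit.BirchSwinnertonDyer.BirchSwinnertonDyer.Rank1Residual.IntModel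

namespace Summit.BirchSwinnertonDyer.BirchSwinnertonDyer.Theorems.TameFineSelmerTrivialRoad

variable (W : WeierstrassCurve ℚ) [W.IsElliptic]

/-! ## §1 The (c3) binder from `E(ℚ_p)[p] = 0` -/

omit [W.IsElliptic] in
/-- **The (c3) clause at the places of `ℚ` above `p` from `E(ℚ_p)[p] = 0`** (Mathlib's `ℚ_[p]`): the place above `p` is unique,
`ℚ_v ≃ ℚ_p` (`Padic.adicCompletionEquiv`) transports the hypothesis to `E(ℚ_v)`, and a `D_v`-fixed geometric `p^∞`-torsion point killed
by `p` descends to `E(ℚ_v)[p]` (`X11b.AcSelmer.eq_zero_of_fixed_decomp_of_local`). [cite: DeoRaySujatha2023, §3 Thm. 3.9 (c3)]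
[cite: NeukirchANT1999, Ch. II §2] -/
theorem hlocp_of_padic {p : ℕ} [Fact p.Prime]
    (hQp : ∀ Q : (W.baseChange ℚ_[p]).toAffine.Point, p • Q = 0 → Q = 0) :
    ∀ v : HeightOneSpectrum (𝓞 ℚ), ((p : ℕ) : 𝓞 ℚ) ∈ v.asIdeal →
      ∀ x : W.geomPrimaryTorsion p, p • x = 0 → (∀ d ∈ decomp v, d • x = x) → x = 0 := by
  have hp : p.Prime := Fact.out
  set v₀ : HeightOneSpectrum (𝓞 ℚ) := (primesEquiv (R := 𝓞 ℚ)).symm ⟨p, hp⟩ with hv₀def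
  have hv₀ : ((p : ℕ) : 𝓞 ℚ) ∈ v₀.asIdeal := (natCast_mem_asIdeal_iff_eq_primesEquiv_symm v₀ hp).mpr rfl
  -- transport `E(ℚ_p)[p] = 0` to `E(ℚ_{v₀})[p] = 0`
  let e : v₀.adicCompletion ℚ →+* ℚ_[p] :=
    (Padic.adicCompletionEquiv (𝓞 ℚ) ⟨p, hp⟩).symm.toAlgEquiv.toRingEquiv.toRingHom
  have hv₀loc : ∀ R : (W.baseChange (v₀.adicCompletion ℚ)).toAffine.Point, p • R = 0 → R = 0 := by
    intro R hR
    have hmap := hQp (WeierstrassCurve.Affine.Point.map e.toRatAlgHom R) (by rw [← map_nsmul, hR, map_zero])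
    exact WeierstrassCurve.Affine.Point.map_injective (W' := W) e.toRatAlgHom (by rw [hmap, map_zero])
  have h₀ : ∀ x : W.geomPrimaryTorsion p, p • x = 0 → (∀ d ∈ decomp v₀, d • x = x) → x = 0 :=
    fun x hx hfix ↦ Summit.BirchSwinnertonDyer.Rank1Residual.X11b.AcSelmer.eq_zero_of_fixed_decomp_of_local W p v₀
      hv₀loc x hfix hx
  exact forall_of_natCast_mem_asIdeal hp v₀ hv₀ h₀

/-- **The whole (c3) binder `hloc` from ONE divisibility and `E(ℚ_p)[p] = 0`** (`p ≥ 5`, `W` globally minimal): if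
`Δ_min ∣ p^a · c₄^b` (every bad `ℓ ≠ p` is additive, `E[p^∞]^{I_ℓ} = 0`) and `E(ℚ_p)[p] = 0`, then the binder of the Selmer-trivial
/ Deo–Ray–Sujatha roads holds. [cite: DeoRaySujatha2023, §3 Thm. 3.9 (c3)] [cite: SilvermanAEC2009, VII.5 Prop. 5.1 and VII.6 Thm. 6.1] -/
theorem hloc_of_dvd_pow_mul_pow_of_padic [W.IsGloballyMinimal] {p : ℕ} [Fact p.Prime] (hp5 : 5 ≤ p) {a b : ℕ}
    (hrad : minimalDiscriminantInt W ∣ (p : ℤ) ^ a * (integralModelInt W).c₄ ^ b)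
    (hQp : ∀ Q : (W.baseChange ℚ_[p]).toAffine.Point, p • Q = 0 → Q = 0) :
    ∀ v : HeightOneSpectrum (𝓞 ℚ), (((p : ℕ) : 𝓞 ℚ) ∈ v.asIdeal ∨ ¬ W.HasGoodReductionAt v) →
      ∀ x : W.geomPrimaryTorsion p, p • x = 0 → (∀ d ∈ decomp v, d • x = x) → x = 0 := by
  have hp : p.Prime := Fact.out
  have hv₀ : ((p : ℕ) : 𝓞 ℚ) ∈ ((primesEquiv (R := 𝓞 ℚ)).symm ⟨p, hp⟩).asIdeal :=
    (natCast_mem_asIdeal_iff_eq_primesEquiv_symm _ hp).mpr rfl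
  exact W.geomPrimaryTorsion_decomp_fixed_eq_zero_of_dvd_pow_mul_pow hp hp5 hrad _ hv₀ (hlocp_of_padic W hQp _ hv₀)

/-! ## §2 The arithmetic binders in the lane's currency -/

/-- **`p ∤ #E(ℚ)` at analytic rank `0` with `E[p]` irreducible**: `E(ℚ)` is finite (GZK `hGZK` + Mordell–Weil) and has no point of
order `p` (a rational `p`-torsion point spans a Galois-stable line of `E[p]`; Mazur III.§5). [cite: Darmon2004, Thm. 3.22]
[cite: Mazur1977, Ch. III §5 (p. 157)] -/
theorem not_dvd_natCard_point_of_irr (hGZK : rank_eq_analyticRank_of_analyticRank_le_one) {p : ℕ} [Fact p.Prime]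
    (hr : W.analyticRank = 0) (hirr : W.HasIrreducibleModPGaloisRep p) : ¬ p ∣ Nat.card W.toAffine.Point := by
  have hp : p.Prime := Fact.out
  haveI := finite_point_of_analyticRank_eq_zero W hGZK hr
  have hcop := coprime_natCard_point_of_irr W p hirr
  intro hdvd
  exact hp.one_lt.ne' (Nat.Coprime.eq_one_of_dvd hcop.symm hdvd)

/-- **`p ∤ #Ш(E/ℚ)` from the row's U₀ statement and `#Ш_an` prime to `p`** (analytic rank `≤ 1`): `Ш(E/ℚ)` is finite (GZK), so
`#Ш ≠ 0`; U₀ reads `ord_p #Ш ≤ ord_p #Ш_an = ord_p s ≤ 0`. Bookkeeping. [cite: Miller2011LMS, Def. 1.1 (arXiv:1010.2431 p. 3)]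
[cite: Darmon2004, Thm. 3.22] -/
theorem not_dvd_shaOrder_of_missingUpperBoundAt (hGZK : rank_eq_analyticRank_of_analyticRank_le_one) {p : ℕ} [Fact p.Prime]
    (hr1 : W.analyticRank ≤ 1) (hU : MissingUpperBoundAt W p) {s : ℚ} (hs : shaAn W = (s : ℂ)) (hsv : padicValRat p s ≤ 0) :
    ¬ p ∣ W.shaOrder := by
  have hp : p.Prime := Fact.out
  haveI hfin : Finite W.sha := (hGZK W hr1).2
  have hpos : 0 < W.shaOrder := W.shaOrder_pos hfin
  obtain ⟨q, hq, hle⟩ := hU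
  have hqs : q = s := by exact_mod_cast hq.symm.trans hs
  subst hqs
  intro hdvd
  have h1 : 1 ≤ padicValNat p W.shaOrder := (padicValNat_dvd_iff_le hpos.ne').mp (by simpa using hdvd)
  have h2 : ((padicValNat p W.shaOrder : ℕ) : ℤ) ≤ 0 := hle.trans hsv
  omega

/-! ## §3 The doors -/

/-- **(A) at `(E,p)` — record form with conjA-anchor g24's displayed binders `hMW : p ∤ #E(ℚ)`, `hsha : p ∤ #Ш(E/ℚ)` and the (c3) binder
IN THE KERNEL** from `Δ_min ∣ p^a c₄^b` (all bad `ℓ ≠ p` additive) and `E(ℚ_p)[p] = 0`; `p ≥ 5`, `W` globally minimal.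
[cite: CoatesSujatha2005, §3 statement (A)] [cite: RaySujatha2021, Cor. 2.7 (arXiv:2112.13335 p. 6)] [cite: DeoRaySujatha2023, Thm. 3.9 (c3)] -/
theorem conjAAt_of_not_dvd_of_dvd_pow_mul_pow_of_padic [W.IsGloballyMinimal] {p : ℕ} [Fact p.Prime] (hp5 : 5 ≤ p)
    (hMW : ¬ p ∣ Nat.card W.toAffine.Point) (hsha : ¬ p ∣ W.shaOrder) {a b : ℕ}
    (hrad : minimalDiscriminantInt W ∣ (p : ℤ) ^ a * (integralModelInt W).c₄ ^ b)
    (hQp : ∀ Q : (W.baseChange ℚ_[p]).toAffine.Point, p • Q = 0 → Q = 0) :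
    Rank1Residual.ConjAAt W p :=
  CoatesSujatha2005.SelmerTrivialRoad.conjAAt_of_not_dvd_card_of_not_dvd_shaOrder W (by omega) hMW hsha
    (hloc_of_dvd_pow_mul_pow_of_padic W hp5 hrad hQp)

/-- **(A) at `(E,p)` from the row's U₀ statement — the lane's form.** For `W/ℚ` globally minimal of analytic rank `0` with `E[p]`
irreducible (`p ≥ 5`): GZK (`hGZK`), U₀ at `(E,p)` (`hU : MissingUpperBoundAt W p`, any of the row's U₀ records), ONE datum
`#Ш_an(E) = s` with `ord_p s ≤ 0`, the divisibility `Δ_min ∣ p^a c₄^b` and `E(ℚ_p)[p] = 0` give Coates–Sujatha (A) at `(E,p)`: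
`E(ℚ)` finite of order prime to `p`, `Ш(E/ℚ)` finite of order prime to `p`, `Sel_p(E/ℚ) = 0`, (c3), `Sel₀(ℚ_∞,E[p]) = 0`, (A).
NOT a road to U₀ (it consumes U₀). [cite: CoatesSujatha2005, §3 statement (A)] [cite: RaySujatha2021, Cor. 2.7] [cite: GreenbergLNM1716, §3]
[cite: Miller2011LMS, Def. 1.1] -/
theorem conjAAt_of_missingUpperBoundAt_of_padic [W.IsGloballyMinimal] (hGZK : rank_eq_analyticRank_of_analyticRank_le_one)
    {p : ℕ} [Fact p.Prime] (hp5 : 5 ≤ p) (hr : W.analyticRank = 0) (hirr : W.HasIrreducibleModPGaloisRep p)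
    (hU : MissingUpperBoundAt W p) {s : ℚ} (hs : shaAn W = (s : ℂ)) (hsv : padicValRat p s ≤ 0) {a b : ℕ}
    (hrad : minimalDiscriminantInt W ∣ (p : ℤ) ^ a * (integralModelInt W).c₄ ^ b)
    (hQp : ∀ Q : (W.baseChange ℚ_[p]).toAffine.Point, p • Q = 0 → Q = 0) :
    Rank1Residual.ConjAAt W p :=
  conjAAt_of_not_dvd_of_dvd_pow_mul_pow_of_padic W hp5 (not_dvd_natCard_point_of_irr W hGZK hr hirr)
    (not_dvd_shaOrder_of_missingUpperBoundAt W hGZK (by omega) hU hs hsv) hrad hQp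

/-- **The same door with a GENERAL (c3) binder away from `p`** (rows with a multiplicative bad prime: the clause there is displayed):
`hbad` supplies the clause at every bad `v ∤ p`, the clause at `v ∋ p` comes from `E(ℚ_p)[p] = 0`. [cite: CoatesSujatha2005, §3 statement (A)]
[cite: DeoRaySujatha2023, Thm. 3.9 (c3)] -/
theorem conjAAt_of_missingUpperBoundAt_of_padic_of_away (hGZK : rank_eq_analyticRank_of_analyticRank_le_one)
    {p : ℕ} [Fact p.Prime] (hp2 : p ≠ 2) (hr : W.analyticRank = 0) (hirr : W.HasIrreducibleModPGaloisRep p)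
    (hU : MissingUpperBoundAt W p) {s : ℚ} (hs : shaAn W = (s : ℂ)) (hsv : padicValRat p s ≤ 0)
    (hbad : ∀ v : HeightOneSpectrum (𝓞 ℚ), ¬ W.HasGoodReductionAt v → ((p : ℕ) : 𝓞 ℚ) ∉ v.asIdeal →
      ∀ x : W.geomPrimaryTorsion p, p • x = 0 → (∀ d ∈ decomp v, d • x = x) → x = 0)
    (hQp : ∀ Q : (W.baseChange ℚ_[p]).toAffine.Point, p • Q = 0 → Q = 0) :
    Rank1Residual.ConjAAt W p := by
  refine CoatesSujatha2005.SelmerTrivialRoad.conjAAt_of_not_dvd_card_of_not_dvd_shaOrder W hp2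
    (not_dvd_natCard_point_of_irr W hGZK hr hirr) (not_dvd_shaOrder_of_missingUpperBoundAt W hGZK (by omega) hU hs hsv) ?_
  intro v hv x hx hfix
  by_cases hpv : ((p : ℕ) : 𝓞 ℚ) ∈ v.asIdeal
  · exact hlocp_of_padic W hQp v hpv x hx hfix
  · exact hbad v (hv.resolve_left hpv) hpv x hx hfix

end Summit.BirchSwinnertonDyer.BirchSwinnertonDyer.Theorems.TameFineSelmerTrivialRoad

end
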